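import Summits.BirchSwinnertonDyer.BirchSwinnertonDyer.Theorems.ThetaPartnerAtTwoSignedMainConjectureCMTwoRankZeroTorsionOfPoitouTate
import Summits.BirchSwinnertonDyer.BirchSwinnertonDyer.Theorems.ThetaPartnerAtTwoSignedControlAtTwoStubPoitouTateShaRat
import Summits.BirchSwinnertonDyer.BirchSwinnertonDyer.Theorems.ThetaPartnerAtTwoSignedControlAtTwoStubPoitouTateSelmerRat
import Summits.BirchSwinnertonDyer.BirchSwinnertonDyer.Theorems.ThetaPartnerAtTwoSignedControlAtTwoShaThreeBaseH3Units
import Literature.NumberTheory.GaloisCohomology.PoitouTateTwoRealPlacesSurjectiveHolds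
import HarnessLib

/-!
# The signed Γ-Euler characteristic at `p = 2`, `Ш²(ℚ, E[2^∞]) = 0` and «`X⁺(E/ℚ_∞)` is `Λ`-torsion» for curves with
# FINITE `Sel_{2^∞}(E/ℚ)` — HYPOTHESIS-FREE (the four generic Poitou–Tate rows over `ℚ` discharged)

Routes `ThetaPartnerAtTwo` / `ResidualThetaTransportAtTwo` (TP2 / RTT).  The K4 lineage (crux `SignedControlAtTwo`,
stmt-BirchSwinnertonDyer-20309, CLOSED 2026-08-28 11:42Z) left three conditional doors keyed on the four generic Poitou–Tate rows
over `ℚ` {Milne *ADT* I Thm. 4.10 (b) `poitouTate_selmerStructure_duality ℚ`, Thm. 4.10 (a) `poitouTate_sha_tateDual ℚ`,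
Thm. 4.10 (c)₃ `poitouTate_three_realPlaces_injective ℚ`, Cor. 4.16 `poitouTate_two_realPlaces_surjective ℚ`}:

* width seat w2's `SignedEC.ShaTwo.stub_shaTwoPrimaryVanishing_of_poitouTate` (`Ш²(ℚ, E[2^∞]) = 0` ⟸ PT(a), 4.10(c)₃, 4.16;
  p613197);
* seat bsd-inputs-k4-p1's `SignedEC.TorsionPT.signedEulerCharTwo_of_poitouTate_four` ((EC2): the signed Γ-Euler characteristic
  ⟸ PT⁴) and `SignedEC.TorsionPT.signedTorsionTwoRankZero_of_poitouTate` ((T): `X⁺` torsion at analytic rank `0` ⟸ GZK + PT⁴)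
  (`…SignedMainConjectureCMTwoRankZeroTorsionOfPoitouTate`).

Since 11:36Z all four rows are THEOREMS of the tree — `SignedEC.PoitouTateSelmerRat.stub_poitouTateSelmerRat` (p625615, cell
bsd-schneider door-c4), `SignedEC.PoitouTateShaRat.stub_poitouTateShaRat` (p629917, seat bsd-inputs-k4-p1 over doors c4/c5 and the
`Ш²`-readout road), `SignedEC.ShaThreeBrauer.poitouTate_three_realPlaces_injective_holds ℚ` (p628282, width seat w3 g9),
`poitouTate_two_realPlaces_surjective_holds ℚ` (p618871, width seat w2 g6).  This file discharges them.  For `E/ℚ` globally minimal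
with good supersingular reduction at `2` and `a₂ = 0`, `κ` the cyclotomic `ℤ₂`-extension with topological generator `γ`:

* `shaTwoPrimary_eq_zero_of_finiteSelmer` — `Sel_{2^∞}(E/ℚ)` finite ⟹ `Ш²(ℚ, E[2^∞]) = 0`;
* `resTwo_injective_of_finiteSelmer` — `Sel_{2^∞}(E/ℚ)` finite ⟹ `res : H²(Γ_ℚ, E[2^∞]) → H²(Gal(ℚ̄/ℚ_∞), E[2^∞])` is injective
  (any `ℤ₂`-extension `κ`);
* **`signedEulerCharTwo_of_finiteSelmer`** — `Sel_{2^∞}(E/ℚ)` finite ⟹ `(Sel⁺(E/ℚ_∞))^γ` is finite and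
  `#(Sel⁺_∞)^γ = u · 2^{v₂(∏ c_ℓ)} · #Sel_{2^∞}(E/ℚ) · #(Sel⁺_∞)_γ` for a `2`-adic unit `u` (B. D. Kim 2013 Cor. 3.15 in
  Euler-characteristic form, at `p = 2`);
* **`signedTorsionTwo_of_finiteSelmer`** — `Sel_{2^∞}(E/ℚ)` finite ⟹ every signed Selmer dual datum `X⁺(E/ℚ_∞)` is `Λ`-torsion
  (Kobayashi 2003 Thm. 1.2 (ii)-shape at `p = 2`);
* `signedTorsionTwoRankZero_of_gzk` — the text of k4-p1's (T) VERBATIM from GZK ALONE (`analyticRank = 0` ⟹ `Sel` finite by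
  Gross–Zagier–Kolyvagin ⟹ torsion).

USE.  The «Greenberg⁵» / «PT⁴» block of the torsion input of K2r0P (`signedTorsionTwoRankZero_of_pub`, line `rankzero` of
stmt-BirchSwinnertonDyer-24945 / 26471) and of the EC2 door in `…_at_of_pub_of_lowerUpToTwoPower_of_flat` / `…_at_unitZone_of_pub`
is now EMPTY: re-key currency for the pen of TP2 (its call); nothing in the K2 line is touched here.

Seat `prover-bsd-wall-tp2-p3-w3` (K4 width 3/3, gen 10), `--supports stmt-BirchSwinnertonDyer-24143` (the Greenberg pack whose uses
these discharges retire).  One-line compositions; nothing re-derived; no landed declaration restated.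

HONEST FRAMING.  The first four theorems are UNCONDITIONAL (standard axioms) statements about curves with finite `Sel_{2^∞}(E/ℚ)`;
the fifth is CONDITIONAL on GZK (`rank_eq_analyticRank_of_analyticRank_le_one`, published).  None of them is a crux; no item is
closed; the signed main conjecture, Kato's divisibility and the CM transport of the routes are untouched; the Birch–Swinnerton-Dyer
conjecture is NOT proved by any of this.

References: [BDKim2013] Cor. 3.15 (p. 199); [Kobayashi2003] Thm. 1.2, §8.4; [MilneADT2006] I Thm. 4.10 (a)(b)(c), Cor. 4.16,
Thm. 6.13; [GreenbergLNM1716] §4 Lemma 4.7, Prop. 4.13 / p. 122; [JetchevSkinnerWan2017] Lemma 3.3.3; [Kolyvagin1990] Thm. A;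
[GrossZagier1986] Thm. I.6.3.
-/

set_option autoImplicit false
-- the Theorems namespace of this sub repeats the summit name by design (D-0017 nested layout)
set_option linter.dupNamespace false

noncomputable section

open scoped Classical NumberField

open NumberField IsDedekindDomain

namespace Summit.BirchSwinnertonDyer.BirchSwinnertonDyer.Theorems.SignedEC.TorsionPT

open Literature.NumberTheory.EllipticCurves Literature.NumberTheory.GaloisRepresentations
  Literature.NumberTheory.GaloisCohomology WeierstrassCurve ZpExtension
  Literature.NumberTheory.EllipticCurves.Kobayashi2003 Literature.NumberTheory.EllipticCurves.IwasawaDual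
  Literature.NumberTheory.EllipticCurves.IwasawaAlgebra Literature.NumberTheory.EllipticCurves.Rank1Residual
open Literature.NumberTheory.GaloisRepresentations.DiscreteGaloisModule (shaTwo)

/-! ## §1 `Ш²(ℚ, E[2^∞]) = 0` and `res²` injective from a finite Selmer group -/

/-- **`Ш²(ℚ, E[2^∞]) = 0` for `E/ℚ` good supersingular at `2` with `a₂ = 0` and `Sel_{2^∞}(E/ℚ)` finite — unconditional.**
Width seat w2's `SignedEC.ShaTwo.stub_shaTwoPrimaryVanishing_of_poitouTate` with PT(a), 4.10(c)₃ and Cor. 4.16 over `ℚ`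
discharged by the tree theorems.  BSD is not proved by this.
[cite: MilneADT2006, Ch. I, Thm. 4.10 (a),(c), Lemma 4.8, Cor. 4.16] [cite: GreenbergLNM1716, §4 p. 119] -/
theorem shaTwoPrimary_eq_zero_of_finiteSelmer (W : WeierstrassCurve ℚ) [W.IsElliptic] [W.IsGloballyMinimal]
    (hss : GoodSS W 2) (ha : W.frobeniusTrace 2 = 0) (hSel : Finite (W.selmerGroupPInfty 2)) :
    ∀ c ∈ shaTwo (Summit.BirchSwinnertonDyer.Rank1Residual.X11b.LocBridge.primaryGaloisModule W 2), c = 0 :=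
  SignedEC.ShaTwo.stub_shaTwoPrimaryVanishing_of_poitouTate SignedEC.PoitouTateShaRat.stub_poitouTateShaRat
    (SignedEC.ShaThreeBrauer.poitouTate_three_realPlaces_injective_holds ℚ) (poitouTate_two_realPlaces_surjective_holds ℚ)
    W hss ha hSel

/-- **`res : H²(Γ_ℚ, E[2^∞]) → H²(Gal(ℚ̄/ℚ_∞), E[2^∞])` is injective** (for ANY `ℤ₂`-extension `κ`, `ℚ_∞ = ℚ̄^{ker κ}`) for
`E/ℚ` good supersingular at `2` with `a₂ = 0` and `Sel_{2^∞}(E/ℚ)` finite — unconditional: width seat w2's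
`SignedEC.ResTwo.resTwo_injective_of_shaTwo` fed by `shaTwoPrimary_eq_zero_of_finiteSelmer`.  This is the `hres` input of the
COINV / EC2 doors.  BSD is not proved by this.
[cite: JetchevSkinnerWan2017, Lemma 3.3.3 (arXiv:1512.06894 p. 12)] [cite: MilneADT2006, Ch. I, Thm. 4.10] -/
theorem resTwo_injective_of_finiteSelmer (W : WeierstrassCurve ℚ) [W.IsElliptic] [W.IsGloballyMinimal]
    (κ : ZpExtension ℚ 2) (hss : GoodSS W 2) (ha : W.frobeniusTrace 2 = 0) (hSel : Finite (W.selmerGroupPInfty 2))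
    (c : galoisCohomology (Summit.BirchSwinnertonDyer.Rank1Residual.X11b.LocBridge.primaryGaloisModule W 2) 2)
    (hc : resSubgroup (Summit.BirchSwinnertonDyer.Rank1Residual.X11b.LocBridge.primaryGaloisModule W 2).toTopRep
      κ.kerSubgroup 2 c = 0) : c = 0 :=
  SignedEC.ResTwo.resTwo_injective_of_shaTwo W κ hss (shaTwoPrimary_eq_zero_of_finiteSelmer W hss ha hSel) c hc

/-! ## §2 The signed Γ-Euler characteristic at `2` and the torsion of `X⁺`, from a finite Selmer group -/

/-- **(EC2) The signed Γ-Euler characteristic at `p = 2` — unconditional.**  For `A/ℚ` globally minimal, good supersingular at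
`2` with `a₂ = 0`, `κ` cyclotomic with topological generator `γ`, and `Sel_{2^∞}(A/ℚ)` finite: `(Sel⁺(A/ℚ_∞))^γ` is finite and
`#(Sel⁺_∞)^γ = u · 2^{v₂(∏ c_ℓ)} · #Sel_{2^∞}(A/ℚ) · #(Sel⁺_∞)_γ` for some `u ∈ ℤ₂ˣ` (B. D. Kim 2013 Cor. 3.15 in Euler-characteristic
form).  Seat k4-p1's `signedEulerCharTwo_of_poitouTate_four` with the four Poitou–Tate rows over `ℚ` discharged — no named fact,
no GZK.  BSD is not proved by this.
[cite: BDKim2013, Cor. 3.15 (p. 199)] [cite: GreenbergLNM1716, §4 Lemma 4.7, Prop. 4.13 / p. 122]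
[cite: MilneADT2006, Ch. I, Thm. 4.10, Cor. 4.16, Thm. 6.13 (c)] -/
theorem signedEulerCharTwo_of_finiteSelmer
    (A : WeierstrassCurve ℚ) [A.IsElliptic] [A.IsGloballyMinimal] (hss : GoodSS A 2) (ha : A.frobeniusTrace 2 = 0)
    (κ : ZpExtension ℚ 2) (hκ : κ.IsCyclotomic) {γ : Field.absoluteGaloisGroup ℚ} (hγ : κ.IsTopGenerator γ)
    (hSel : Finite (A.selmerGroupPInfty 2)) :
    Finite (endInvariants (conjSignedSelmerInfty A κ 1 γ - 1)) ∧
      ∃ u : ℤ_[2]ˣ, (Nat.card (endInvariants (conjSignedSelmerInfty A κ 1 γ - 1)) : ℚ_[2]) =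
        ((u : ℤ_[2]) : ℚ_[2]) * ((2 : ℕ) : ℚ_[2]) ^ (padicValNat 2 A.tamagawaProduct) *
          (Nat.card (A.selmerGroupPInfty 2) : ℚ_[2]) *
            (Nat.card (EndCoinvariants (conjSignedSelmerInfty A κ 1 γ - 1)) : ℚ_[2]) :=
  signedEulerCharTwo_of_poitouTate_four SignedEC.PoitouTateSelmerRat.stub_poitouTateSelmerRat
    SignedEC.PoitouTateShaRat.stub_poitouTateShaRat (SignedEC.ShaThreeBrauer.poitouTate_three_realPlaces_injective_holds ℚ)
    (poitouTate_two_realPlaces_surjective_holds ℚ) A hss ha κ hκ hγ hSel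

/-- **(T) `X⁺(A/ℚ_∞)` is `Λ`-torsion when `Sel_{2^∞}(A/ℚ)` is finite — unconditional** (`A/ℚ` globally minimal, good
supersingular at `2`, `a₂ = 0`; cyclotomic `κ`, topological generator `γ`): a finite `(Sel⁺_∞)^γ` (from (EC2)) forces torsion
(`SignedSelmerDualData.isTorsion_of_finite_endInvariants`).  BSD is not proved by this.
[cite: Kobayashi2003, Thm. 1.2 (p. 2), §8.4] [cite: BDKim2013, Cor. 3.15 (p. 199)] [cite: GreenbergLNM1716, §1 p. 61, §4 Lemma 4.2] -/
theorem signedTorsionTwo_of_finiteSelmer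
    (A : WeierstrassCurve ℚ) [A.IsElliptic] [A.IsGloballyMinimal] (hss : GoodSS A 2) (ha : A.frobeniusTrace 2 = 0)
    (κ : ZpExtension ℚ 2) (hκ : κ.IsCyclotomic) {γ : Field.absoluteGaloisGroup ℚ} (hγ : κ.IsTopGenerator γ)
    (hSel : Finite (A.selmerGroupPInfty 2)) (D : SignedSelmerDualData A κ γ 1) :
    Module.IsTorsion (IwasawaAlgebra 2) D.X :=
  D.isTorsion_of_finite_endInvariants hγ (signedEulerCharTwo_of_finiteSelmer A hss ha κ hκ hγ hSel).1

/-- **(T) at analytic rank `0` from GZK ALONE** — the conclusion of `signedTorsionTwoRankZero_of_pub` /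
`signedTorsionTwoRankZero_of_poitouTate` VERBATIM, its «Greenberg⁵» / «PT⁴» block discharged: `analyticRank A = 0` gives
`Sel_{2^∞}(A/ℚ)` finite by Gross–Zagier–Kolyvagin (`finite_selmerGroupPInfty_two_of_analyticRank_eq_zero`), then
`signedTorsionTwo_of_finiteSelmer`.  Conditional on GZK; BSD is not proved by this.
[cite: Kobayashi2003, Thm. 1.2 (p. 2)] [cite: Kolyvagin1990, Thm. A] [cite: GrossZagier1986, Thm. I.6.3] -/
theorem signedTorsionTwoRankZero_of_gzk (hGZK : rank_eq_analyticRank_of_analyticRank_le_one) :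
    ∀ (A : WeierstrassCurve ℚ) [A.IsElliptic] [A.IsGloballyMinimal],
      A.analyticRank = 0 → GoodSS A 2 → A.frobeniusTrace 2 = 0 →
      ∀ (κ : ZpExtension ℚ 2) (γ : Field.absoluteGaloisGroup ℚ), κ.IsCyclotomic → κ.IsTopGenerator γ →
      ∀ D : SignedSelmerDualData A κ γ 1, Module.IsTorsion (IwasawaAlgebra 2) D.X :=
  fun A _ _ hr hss ha κ _ hκ hγ D ↦
    signedTorsionTwo_of_finiteSelmer A hss ha κ hκ hγ (finite_selmerGroupPInfty_two_of_analyticRank_eq_zero A hGZK hr) D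

end Summit.BirchSwinnertonDyer.BirchSwinnertonDyer.Theorems.SignedEC.TorsionPT

end
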